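import Summits.ValiantsHypothesis.ValiantsHypothesis.Theorems.BarrierLeverAnchoredDoorHitsLowerPairsUQFaceCoreTwo
import Summits.ValiantsHypothesis.ValiantsHypothesis.Theorems.BarrierLeverAnchoredDoorHitsLowerPairsUQFaceStepProof

/-!
# Support item `AnchoredDoorHitsLowerPairs` (stmt-ValiantsHypothesis-22510), line `anchored-peeling`:
# THE UQ² FACE STEP — the face-target UQ step with PAIR-DISTINCT private anchors (stub text, kernel proof, residual, induction)

Prover file (`--supports stmt-ValiantsHypothesis-22510`; cell valiant-natproofs, rung V4, 𝒟-side door (c); registered line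
`Cruxes/AnchoredDoorHitsLowerPairs/Lines/anchored_peeling.lean` v14/v15; prover seat val-np-p1 gen 20). Closes NO item.

The registered step `Stmt.stub_uqFaceStep` (LANDED, p626525) asks for DISTINCT ROOTS `ρ A` (`A ∈ 𝒜`). The kernel proof (`…UQFaceCore`) used distinctness only to
make the private anchors `(ρ A | W₀)` pairwise different. Here the user also chooses the TARGET COLUMNS `β A ∈ st_C(W₀)` (distinct, forming an up-set of the
star of `W₀` — so that the remaining columns form a lower sub-family of `lk_C(W₀)`) and SUB-TARGETS `W₀ ⊆ σ A ⊆ β A` with `|σ A| ≤ s`; the private anchors are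
`(ρ A | σ A)` and only the PAIRS `(ρ A, σ A)` must be distinct (`UQF2Data`). Same two hypotheses (reduced deletion pair; lower sub-pairs of the link pair), same
conclusion. Reach: at `s = 2` the pairs cube₁₀/B(11,5) (`m = 126` > 55 roots, but ≥ 550 pairs) and cube₁₂/B(13,6) acquire a step; the fixed-`s` residual stays
infinite (squarefree barrier p590167: at most `#anchors_s = poly(h)` distinct private anchors against `m ~ C(2k,k)/2`).

* `UQF2Data`, `Stmt.stub_uq2FaceStep` (offered stub text) and **`stub_uq2FaceStep : Stmt.stub_uq2FaceStep` (kernel theorem)**, from `symbolicDet_ne_zero_of_uqFaceCore₂`.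
* `Stmt.stub_uq2FaceResidual` (offered residual text: no UQ² data on either side ⟹ hit) and the kernel induction
  `stub_symbolicNonvanishing_of_uq2Face : Stmt.stub_uq2FaceResidual → Stmt.stub_symbolicNonvanishing`, `anchoredDoorHitsLowerPairs_of_uq2FaceResidual` (route decl
  BY NAME). (`UQFData ⟹ UQF2Data` — taking the largest faces through `W₀` as targets and `σ A = W₀` — so the new residual class is contained in the registered one;
  that implication is left to the sequel.)

WHAT THIS IS NOT: no claim on the residual; nothing on crux stmt-ValiantsHypothesis-14610 or on `VP` versus `VNP`.
-/

set_option linter.dupNamespace false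

open Matrix

namespace Summit.ValiantsHypothesis.ValiantsHypothesis.Theorems.BarrierLever.AnchoredPeeling

open Finset MvPolynomial

noncomputable section

variable {h : ℕ}

/-- **UQ² data** for peeling the `x`-vertex `a` onto the column face `W₀` (`1 ≤ |W₀| ≤ s`) at profile `s`: an up-set `𝒜` of deletion faces with
`ℓ_a + |𝒜| = ℓ_{W₀}`, roots `ρ A ⊆ A` (`1 ≤ |ρ A| ≤ s`), distinct target columns `β A ⊇ W₀` forming an up-set of the star of `W₀`, sub-targets
`W₀ ⊆ σ A ⊆ β A` (`|σ A| ≤ s`), and the anchor pairs `(ρ A, σ A)` pairwise distinct. -/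
def UQF2Data (s : ℕ) {r : ℕ} (u w : Fin r → Finset (Fin h)) (a : Fin h) (W₀ : Finset (Fin h)) (𝒜 : Finset (Finset (Fin h)))
    (ρ β σ : Finset (Fin h) → Finset (Fin h)) : Prop :=
  (∃ i, a ∈ u i) ∧ W₀ ∈ Set.range w ∧ 1 ≤ W₀.card ∧ W₀.card ≤ s ∧
  (∀ A ∈ 𝒜, A ∈ Set.range u ∧ a ∉ A) ∧
  (∀ A ∈ 𝒜, ∀ i, A ⊆ u i → a ∉ u i → u i ∈ 𝒜) ∧
  (Finset.univ.filter (fun i => a ∈ u i)).card + 𝒜.card = (Finset.univ.filter (fun j => W₀ ⊆ w j)).card ∧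
  (∀ A ∈ 𝒜, ρ A ⊆ A ∧ 1 ≤ (ρ A).card ∧ (ρ A).card ≤ s) ∧
  (∀ A ∈ 𝒜, β A ∈ Set.range w ∧ W₀ ⊆ β A) ∧ Set.InjOn β (↑𝒜 : Set (Finset (Fin h))) ∧
  (∀ A ∈ 𝒜, ∀ j, β A ⊆ w j → ∃ A' ∈ 𝒜, β A' = w j) ∧
  (∀ A ∈ 𝒜, W₀ ⊆ σ A ∧ σ A ⊆ β A ∧ (σ A).card ≤ s) ∧
  Set.InjOn (fun A => (ρ A, σ A)) (↑𝒜 : Set (Finset (Fin h)))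

/-- **STUB TEXT (offered): THE UQ² FACE STEP.** Given UQ² data at `(a, W₀)`, non-vanishing of the symbolic minors of the core pairs
`(del_a R ∖ 𝒜, C ∖ st_C(W₀))` and `(lk_a R, K₀)` (every injective lower `K₀` inside `lk_C(W₀)`) implies non-vanishing for `(R, C)`. -/
def Stmt.stub_uq2FaceStep : Prop :=
  ∀ (s h r : ℕ) (u w : Fin r → Finset (Fin h)), 1 ≤ s → Function.Injective u → Function.Injective w →
    IsLowerSet (Set.range u) → IsLowerSet (Set.range w) →
    ∀ (a : Fin h) (W₀ : Finset (Fin h)) (𝒜 : Finset (Finset (Fin h))) (ρ β σ : Finset (Fin h) → Finset (Fin h)), UQF2Data s u w a W₀ 𝒜 ρ β σ →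
      (∀ (r₀ : ℕ) (u₀ w₀ : Fin r₀ → Finset (Fin h)), Function.Injective u₀ → Function.Injective w₀ →
          Set.range u₀ = {S | S ∈ Set.range u ∧ a ∉ S ∧ S ∉ 𝒜} → Set.range w₀ = {T | T ∈ Set.range w ∧ ¬ W₀ ⊆ T} →
          symbolicDet s h r₀ u₀ w₀ ≠ 0) →
      (∀ (r₁ : ℕ) (u₁ w₁ : Fin r₁ → Finset (Fin h)), Function.Injective u₁ → Function.Injective w₁ →
          Set.range u₁ = {S | a ∉ S ∧ insert a S ∈ Set.range u} → Set.range w₁ ⊆ {T | Disjoint T W₀ ∧ T ∪ W₀ ∈ Set.range w} →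
          IsLowerSet (Set.range w₁) → symbolicDet s h r₁ u₁ w₁ ≠ 0) →
      symbolicDet s h r u w ≠ 0

/-- **STUB TEXT (offered): THE UQ² RESIDUAL.** At some fixed profile `s ≥ 1` and all `h ≥ h₀`: every injective simplicial-complex pair with `r ≥ 2` rows
that admits NO UQ² data on the `x`-side and none on the `y`-side has nonzero symbolic minor. -/
def Stmt.stub_uq2FaceResidual : Prop :=
  ∃ s h₀ : ℕ, 1 ≤ s ∧ ∀ h : ℕ, h₀ ≤ h → ∀ (r : ℕ) (u w : Fin r → Finset (Fin h)),
    Function.Injective u → Function.Injective w → IsLowerSet (Set.range u) → IsLowerSet (Set.range w) → 2 ≤ r →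
    (∀ (a : Fin h) (W₀ : Finset (Fin h)) (𝒜 : Finset (Finset (Fin h))) (ρ β σ : Finset (Fin h) → Finset (Fin h)), ¬ UQF2Data s u w a W₀ 𝒜 ρ β σ) →
    (∀ (c : Fin h) (Z : Finset (Fin h)) (𝒜 : Finset (Finset (Fin h))) (ρ β σ : Finset (Fin h) → Finset (Fin h)), ¬ UQF2Data s w u c Z 𝒜 ρ β σ) →
    symbolicDet s h r u w ≠ 0

/-! ## The step -/

/-- **THE UQ² FACE STEP (kernel theorem; offered stub `Stmt.stub_uq2FaceStep` by name).** -/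
theorem stub_uq2FaceStep : Stmt.stub_uq2FaceStep := by
  classical
  intro s h r u w hs hu hw hlu hlw a W₀ 𝒜 ρ β σ hD Hdel Hlink
  obtain ⟨-, -, hW1, hWs, h𝒜, hup, hcard, hρ, hβ, hβinj, hβup, hσ, hpairinj⟩ := hD
  obtain ⟨c, hc⟩ := Finset.card_pos.mp hW1
  have hFD : insert c (W₀.erase c) = W₀ := Finset.insert_erase hc
  -- (1) deletion rows: kept ⊕ κ
  let X := {i : Fin r // ¬ (a ∈ u i)}
  let Pk : X → Prop := fun x => u x.1 ∉ 𝒜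
  let κ := {x : X // ¬ Pk x}
  let n : ℕ := Fintype.card {x : X // Pk x}
  let eFin : {x : X // Pk x} ≃ Fin n := Fintype.equivFinOfCardEq rfl
  let e : X ≃ Fin n ⊕ κ := (Equiv.sumCompl Pk).symm.trans (Equiv.sumCongr eFin (Equiv.refl κ))
  have he_inr : ∀ k : κ, e.symm (Sum.inr k) = k.1 := fun k => by
    simp [e, Equiv.sumCongr_symm, Equiv.sumCongr_apply]
    rfl
  have he_inl : ∀ x : Fin n, e.symm (Sum.inl x) = (eFin.symm x).1 := fun x => by
    simp [e, Equiv.sumCongr_symm, Equiv.sumCongr_apply]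
  have hκmem : ∀ k : κ, u k.1.1 ∈ 𝒜 := fun k => not_not.mp k.2
  -- (2) cardinalities
  let ℓa : ℕ := Fintype.card {i : Fin r // a ∈ u i}
  have hℓa : ℓa = (Finset.univ.filter (fun i => a ∈ u i)).card := Fintype.card_subtype _
  have hℓW : Fintype.card {j : Fin r // W₀ ⊆ w j} = (Finset.univ.filter (fun j => W₀ ⊆ w j)).card := Fintype.card_subtype _
  have hℓa_le : ℓa ≤ r := (Fintype.card_subtype_le _).trans (by rw [Fintype.card_fin])
  have hℓW_le : Fintype.card {j : Fin r // W₀ ⊆ w j} ≤ r := (Fintype.card_subtype_le _).trans (by rw [Fintype.card_fin])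
  have hXcard : Fintype.card X = r - ℓa := by
    show Fintype.card {i : Fin r // ¬ (a ∈ u i)} = r - ℓa
    rw [Fintype.card_subtype_compl, Fintype.card_fin]
  have hκcard : Fintype.card κ = 𝒜.card := by
    rw [← Fintype.card_coe 𝒜]
    refine Fintype.card_of_bijective (f := fun k : κ => (⟨u k.1.1, hκmem k⟩ : 𝒜)) ⟨fun k k' hkk => ?_, fun A => ?_⟩
    · exact Subtype.ext (Subtype.ext (hu (congrArg Subtype.val hkk)))
    · obtain ⟨⟨i, hi⟩, haA⟩ := h𝒜 A.1 A.2
      refine ⟨⟨⟨i, by rw [hi]; exact haA⟩, fun hP => hP (by show u i ∈ 𝒜; rw [hi]; exact A.2)⟩, Subtype.ext hi⟩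
  have hXsplit : Fintype.card X = n + Fintype.card κ := by
    rw [← Fintype.card_sum]
    exact Fintype.card_congr (Equiv.sumCompl Pk).symm
  have hYcard : Fintype.card {j : Fin r // ¬ ¬ (W₀ ⊆ w j)} = Fintype.card {j : Fin r // W₀ ⊆ w j} := by
    rw [Fintype.card_subtype_compl, Fintype.card_subtype_compl, Fintype.card_fin]
    omega
  have hQcard : Fintype.card {j : Fin r // ¬ (W₀ ⊆ w j)} = n := by
    rw [Fintype.card_subtype_compl, Fintype.card_fin]
    omega
  -- (3) columns: `q`-columns ≃ Fin n; link rows ≃ Fin ℓa; W₀-columns = kept (non-targets) ⊕ κ (targets, matched by β)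
  let eQ : {j : Fin r // ¬ (W₀ ⊆ w j)} ≃ Fin n := Fintype.equivFinOfCardEq hQcard
  let eP : {i : Fin r // a ∈ u i} ≃ Fin ℓa := Fintype.equivFinOfCardEq rfl
  let Y := {j : Fin r // ¬ ¬ (W₀ ⊆ w j)}
  have hYW : ∀ y : Y, W₀ ⊆ w y.1 := fun y => not_not.mp y.2
  let PJ : Y → Prop := fun y => ¬ ∃ A ∈ 𝒜, β A = w y.1
  -- the matched column of a deleted row
  have hcol : ∀ k : κ, ∃ j : Fin r, w j = β (u k.1.1) := fun k => by
    obtain ⟨⟨j, hj⟩, -⟩ := hβ _ (hκmem k); exact ⟨j, hj⟩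
  choose jκ hjκ using hcol
  have hjκY : ∀ k, ¬ ¬ (W₀ ⊆ w (jκ k)) := fun k => not_not.mpr (by rw [hjκ]; exact (hβ _ (hκmem k)).2)
  let g : κ → {y : Y // ¬ PJ y} := fun k => ⟨⟨jκ k, hjκY k⟩, not_not.mpr ⟨u k.1.1, hκmem k, (hjκ k).symm⟩⟩
  have hg : Function.Bijective g := by
    constructor
    · intro k k' hkk
      have h1 : jκ k = jκ k' := congrArg (fun z => z.1.1) hkk
      have h2 : β (u k.1.1) = β (u k'.1.1) := by rw [← hjκ k, ← hjκ k', h1]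
      exact Subtype.ext (Subtype.ext (hu (hβinj (hκmem k) (hκmem k') h2)))
    · intro y
      obtain ⟨A, hA, hAy⟩ := not_not.mp y.2
      obtain ⟨⟨i, hi⟩, haA⟩ := h𝒜 A hA
      let k : κ := ⟨⟨i, by rw [hi]; exact haA⟩, fun hP => hP (by show u i ∈ 𝒜; rw [hi]; exact hA)⟩
      refine ⟨k, Subtype.ext (Subtype.ext ?_)⟩
      show jκ k = y.1.1
      apply hw
      rw [hjκ k]
      show β (u i) = w y.1.1
      rw [hi, hAy]
  let eD : κ ≃ {y : Y // ¬ PJ y} := Equiv.ofBijective g hg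
  have hDcard : Fintype.card {y : Y // ¬ PJ y} = Fintype.card κ := (Fintype.card_congr eD).symm
  have hJcard : Fintype.card {y : Y // PJ y} = ℓa := by
    have := Fintype.card_subtype_compl (fun y : Y => PJ y)
    rw [hDcard, hκcard, hYcard] at this
    have h2 : Fintype.card {y : Y // PJ y} ≤ Fintype.card Y := Fintype.card_subtype_le _
    rw [hYcard] at h2
    omega
  let eJ : {y : Y // PJ y} ≃ Fin ℓa := Fintype.equivFinOfCardEq hJcard
  let e' : Y ≃ Fin ℓa ⊕ κ := (Equiv.sumCompl PJ).symm.trans (Equiv.sumCongr eJ eD.symm)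
  have he'_inl : ∀ y : Fin ℓa, e'.symm (Sum.inl y) = (eJ.symm y).1 := fun y => by
    simp [e', Equiv.sumCongr_symm, Equiv.sumCongr_apply]
  have he'_inr : ∀ k : κ, (e'.symm (Sum.inr k)).1 = jκ k := fun k => by
    simp [e', Equiv.sumCongr_symm, Equiv.sumCongr_apply, eD, g]
  -- (4) apply the core theorem
  refine symbolicDet_ne_zero_of_uqFaceCore₂ (a := a) (c := c) (D := W₀.erase c) hs hu hw (Finset.notMem_erase c W₀) hFD e eQ eP e'
    ?_ (fun k => ρ (u k.1.1)) ?_ (fun k => σ (u k.1.1)) ?_ ?_ ?_ ?_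
  · -- up-set: no kept row contains a deleted face
    intro k x hsub
    rw [he_inr, he_inl] at hsub
    have hx := (eFin.symm x).2
    exact hx (hup _ (hκmem k) _ hsub (eFin.symm x).1.2)
  · -- roots
    intro k
    rw [he_inr]
    exact hρ _ (hκmem k)
  · -- sub-targets
    intro k
    rw [he'_inr, hjκ]
    exact hσ _ (hκmem k)
  · -- distinct anchor pairs
    intro k k' hkk
    have := hpairinj (hκmem k) (hκmem k') hkk
    exact Subtype.ext (Subtype.ext (hu this))
  · -- (H1): the reduced deletion pair
    let u₀ : Fin n → Finset (Fin h) := fun x => u (e.symm (Sum.inl x)).1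
    let w₀ : Fin n → Finset (Fin h) := fun y => w (eQ.symm y).1
    refine Hdel n u₀ w₀ ?_ ?_ ?_ ?_
    · intro x x' hxx
      exact Sum.inl_injective (e.symm.injective (Subtype.ext (hu hxx)))
    · intro y y' hyy
      exact eQ.symm.injective (Subtype.ext (hw hyy))
    · ext S
      constructor
      · rintro ⟨x, rfl⟩
        refine ⟨⟨_, rfl⟩, (e.symm (Sum.inl x)).2, ?_⟩
        show u (e.symm (Sum.inl x)).1 ∉ 𝒜
        rw [he_inl]
        exact (eFin.symm x).2
      · rintro ⟨⟨i, rfl⟩, hai, hnot⟩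
        refine ⟨eFin ⟨⟨i, hai⟩, hnot⟩, ?_⟩
        show u (e.symm (Sum.inl (eFin ⟨⟨i, hai⟩, hnot⟩))).1 = u i
        rw [he_inl, Equiv.symm_apply_apply]
    · ext T
      constructor
      · rintro ⟨y, rfl⟩
        exact ⟨⟨_, rfl⟩, (eQ.symm y).2⟩
      · rintro ⟨⟨j, rfl⟩, hj⟩
        exact ⟨eQ ⟨j, hj⟩, by show w (eQ.symm (eQ ⟨j, hj⟩)).1 = w j; rw [Equiv.symm_apply_apply]⟩
  · -- (H2): the link pair against the kept (non-target) link columns — a lower sub-pair since the targets form an up-set of the star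
    let u₁ : Fin ℓa → Finset (Fin h) := fun x => (u (eP.symm x).1).erase a
    let w₁ : Fin ℓa → Finset (Fin h) := fun y => w (e'.symm (Sum.inl y)).1 \ W₀
    have hw₁ : ∀ y, w₁ y = w (eJ.symm y).1.1 \ W₀ := fun y => by
      show w (e'.symm (Sum.inl y)).1 \ W₀ = _
      rw [he'_inl]
    have herase_u : ∀ z z' : {i : Fin r // a ∈ u i}, (u z.1).erase a = (u z'.1).erase a → z = z' := by
      intro z z' hzz
      apply Subtype.ext; apply hu
      rw [← Finset.insert_erase z.2, ← Finset.insert_erase z'.2, hzz]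
    refine Hlink ℓa u₁ w₁ ?_ ?_ ?_ ?_ ?_
    · intro x x' hxx
      exact eP.symm.injective (herase_u _ _ hxx)
    · intro y y' hyy
      rw [hw₁, hw₁] at hyy
      have h1 := Finset.sdiff_union_of_subset (hYW (eJ.symm y).1)
      have h2 := Finset.sdiff_union_of_subset (hYW (eJ.symm y').1)
      have : w (eJ.symm y).1.1 = w (eJ.symm y').1.1 := by rw [← h1, ← h2, hyy]
      exact eJ.symm.injective (Subtype.ext (Subtype.ext (hw this)))
    · ext S
      constructor
      · rintro ⟨x, rfl⟩
        refine ⟨Finset.notMem_erase a _, ⟨(eP.symm x).1, ?_⟩⟩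
        show u (eP.symm x).1 = insert a ((u (eP.symm x).1).erase a)
        rw [Finset.insert_erase (eP.symm x).2]
      · rintro ⟨haS, ⟨i, hi⟩⟩
        have hai : a ∈ u i := by rw [hi]; exact Finset.mem_insert_self a S
        refine ⟨eP ⟨i, hai⟩, ?_⟩
        show (u (eP.symm (eP ⟨i, hai⟩)).1).erase a = S
        rw [Equiv.symm_apply_apply, hi, Finset.erase_insert haS]
    · rintro T ⟨y, rfl⟩
      rw [hw₁]
      refine ⟨Finset.sdiff_disjoint, ⟨(eJ.symm y).1.1, ?_⟩⟩
      rw [Finset.sdiff_union_of_subset (hYW _)]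
    · intro T T' hT'T hT
      obtain ⟨y, rfl⟩ := hT
      rw [hw₁] at hT'T
      have hj : W₀ ⊆ w (eJ.symm y).1.1 := hYW _
      have hdisj : Disjoint T' W₀ := Finset.disjoint_of_subset_left hT'T Finset.sdiff_disjoint
      have hsub : T' ∪ W₀ ⊆ w (eJ.symm y).1.1 := by
        rw [← Finset.sdiff_union_of_subset hj]
        exact Finset.union_subset_union hT'T subset_rfl
      obtain ⟨j', hj'⟩ := hlw hsub ⟨(eJ.symm y).1.1, rfl⟩
      have hWj' : W₀ ⊆ w j' := by rw [hj']; exact Finset.subset_union_right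
      let y' : Y := ⟨j', not_not.mpr hWj'⟩
      have hy'J : PJ y' := by
        rintro ⟨A, hA, hAy'⟩
        -- a target below a kept column would make the kept column a target (targets are an up-set of the star)
        have hle : β A ⊆ w (eJ.symm y).1.1 := by
          show β A ⊆ w (eJ.symm y).1.1
          rw [hAy']; show w j' ⊆ _; rw [hj']; exact hsub
        obtain ⟨A', hA', hA'y⟩ := hβup A hA _ hle
        exact (eJ.symm y).2 ⟨A', hA', hA'y⟩
      refine ⟨eJ ⟨y', hy'J⟩, ?_⟩
      show w₁ (eJ ⟨y', hy'J⟩) = T'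
      rw [hw₁, Equiv.symm_apply_apply]
      show w j' \ W₀ = T'
      rw [hj', Finset.union_sdiff_cancel_right hdisj]

end

end Summit.ValiantsHypothesis.ValiantsHypothesis.Theorems.BarrierLever.AnchoredPeeling
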